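import Summits.BirchSwinnertonDyer.Rank1Residual.X12.O11.RamifiedStrictDescent
import Literature.NumberTheory.EllipticCurves.BurungaleKobayashiNakamuraOta2026.AnticyclotomicEllipticUnitClass
import HarnessLib

set_option linter.dupNamespace false
set_option autoImplicit false

/-!
# Route `RamifiedSevenEllipticUnits` (rung K7r), crux `EllipticUnitIndexSeven`
# (stmt-BirchSwinnertonDyer-19143): the BOTTOM INDEX EXPONENT of the anticyclotomic elliptic-unit
# class is WELL DEFINED over an O11 frame — RELATIVE to the dual-exponential datum (`--supports 19143`)

Cell `bsd-cm`, seat `bsd-cm-ram` g7 (T-K7r-OBJ phase β, planner D88/D93/D100; rider R1 «binder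
compatibility»). HONEST FRAMING: nothing here closes the crux, the leaf or any item; BSD is not
proved; no named fact is minted. This file only shows, in the kernel, that the Literature interface
`Literature/NumberTheory/EllipticCurves/BurungaleKobayashiNakamuraOta2026/AnticyclotomicEllipticUnitClass.lean`
(p441800) plugs into the O11 frame currency of `X12/O11/RamifiedStrictDescent.lean`: the frame
predicate `X12.O11.IsFrame W p K 𝔭 W' C` supplies exactly the hypotheses (`W.HasCM`, `CMRamified W p`,
`5 ≤ p`, `IsImaginaryQuadratic K`, `discr K = cmFieldDiscrOfJ W.j`) under which the PREPRINT claim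
`prop37_lemma52_compactAcSelmerVanishes_CLAIMED` ([BKNO] Prop. 3.7 (3) + Lemma 5.2: the compact
anticyclotomic Selmer module vanishes) makes the elliptic-unit class, hence its bottom index exponent
`c` (`EllipticUnitClassData.HasBottomIndexExp D c` — the cell's `ord_π 𝔠`), independent of the
datum `D` — RELATIVE to the fixed parameters `(ι, φ, Ω, 𝓔)`.

* `bottomIndexExp_iff_of_frame` — for a framed pair and an anticyclotomic tower with topological
  generator, two data `D`, `D'` over the same `(ι, φ, Ω, 𝓔)` have the same bottom index exponents,
  GIVEN the claim and entire continuations of the `L(φχ, s)` (binder `hcont`). CONDITIONAL (the claim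
  is an unrefereed-preprint input); nothing booked.
* `bottomIndexExp_unique_of_frame` — and at most one exponent per datum (re-export).
* `bottom_mem_compactSelmerOver` (appended, planner D112 (e) stub (B1)) — the bottom class `z 0` of
  every datum lies in the FULL compact Selmer group `S_p(E/K)` (Kummer at `𝔭` too), given the
  vanishing of the central values of the level-`0` twists (`L(φ,1) = 0` in rank one): [BKNO] Lemma 7.1
  at `χ = 𝟙` via `erl` + the exact-kernel reading; `bottom_apply_mem_selmerTorsionOver` levelwise.

WHY ONLY RELATIVE (design memo `HOME/bsd-cm-ram/queue-g7/BETA-DESIGN-ram-g7.md` §2, kernel-checked by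
`EllipticUnitClassData.scaleByP`): the readings of the abstract dual-exponential datum `𝓔` do not pin
its integral normalisation ([BKNO] §1.4's deferred `p`-adic periods), so a CLOSED predicate
`∃ 𝓔 D, D.HasBottomIndexExp c` would hold for `c` and `c + 2` at once; every statement about `c`
must carry `(Ω, 𝓔, D)` as SHARED binders — which is what the two theorems below do.

References: [BurungaleKobayashiNakamuraOta2026] arXiv:2608.06879v1 Prop. 3.7 (3), Lemma 5.2,
Prop. 4.10, §1.4; cell memo BETA-DESIGN-ram-g7.md §§2–3, §7.
-/

noncomputable section

open scoped Classical

open WeierstrassCurve NumberField IsDedekindDomain Field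
  Literature.NumberTheory.EllipticCurves
  Literature.NumberTheory.EllipticCurves.Rank1Residual
  Literature.NumberTheory.GaloisRepresentations
  Literature.NumberTheory.EllipticCurves.BurungaleKobayashiNakamuraOta2026
  Summit.BirchSwinnertonDyer.Rank1Residual
  Summit.BirchSwinnertonDyer.Rank1Residual.X12

namespace Summit.BirchSwinnertonDyer.BirchSwinnertonDyer.Theorems.RamifiedSevenEllipticUnits

namespace BottomClass

variable {W : WeierstrassCurve ℚ} [W.IsElliptic] {p : ℕ} [Fact p.Prime]
  {K : Type} [Field K] [NumberField K] {𝔭 : HeightOneSpectrum (𝓞 K)}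
  {W' : WeierstrassCurve ℚ} {C : VariableChange ℚ}
  {κ : ZpExtension K p} {γ : absoluteGaloisGroup K}
  {ι : PadicAlgCl p ≃+* ℂ} {φ : HeckeCharacter K} {Ω : ℂ} {𝓔 : AcDualExpSystem W p K 𝔭 κ ι}

/-- **Over an O11 frame the bottom index exponent of the elliptic-unit class does not depend on the
datum (relative to `(ι, φ, Ω, 𝓔)`).** For a framed CM pair at the ramified prime
(`X12.O11.IsFrame W p K 𝔭 W' C`), the anticyclotomic `ℤ_p`-extension `κ` with topological generator
`γ`, the PREPRINT claim `prop37_lemma52_compactAcSelmerVanishes_CLAIMED` ([BKNO] Prop. 3.7 (3) +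
Lemma 5.2: `𝒮^{ac}_f = 0`) and entire continuations of the `L(φχ, s)`: any two data
`D D' : EllipticUnitClassData W p K 𝔭 κ γ ι φ Ω 𝓔` have `D.HasBottomIndexExp c ↔ D'.HasBottomIndexExp c`.
Proof: the frame supplies the claim's hypotheses; then `EllipticUnitClassData.hasBottomIndexExp_iff`.
CONDITIONAL on the claim (binder `hclaim`); nothing booked.
[cite: BurungaleKobayashiNakamuraOta2026, Prop. 3.7 (3), Lemma 5.2 and Prop. 4.10 (arXiv:2608.06879 pp. 19–20, 31, 33) (claim; preprint; shape only)] -/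
theorem bottomIndexExp_iff_of_frame (hclaim : prop37_lemma52_compactAcSelmerVanishes_CLAIMED)
    (hF : X12.O11.IsFrame W p K 𝔭 W' C) (hκ : κ.IsAnticyclotomic) (hγ : κ.IsTopGenerator γ)
    (hcont : ∀ χ : HeckeCharacter K, LFunction.HasEntireContinuation (heckeLFunction (φ * χ)))
    (D D' : EllipticUnitClassData W p K 𝔭 κ γ ι φ Ω 𝓔) (c : ℕ) :
    D.HasBottomIndexExp c ↔ D'.HasBottomIndexExp c := by
  obtain ⟨hCM, hram, h5, hK, hdisc, -, -⟩ := hF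
  have hS : CompactAcSelmerVanishes W p K κ γ := hclaim W p K κ γ hCM hram h5 hK hdisc hκ hγ
  exact EllipticUnitClassData.hasBottomIndexExp_iff hS hcont D D' c

/-- **At most one bottom index exponent per datum** (`p^c` is determined; re-export of
`EllipticUnitClassData.hasBottomIndexExp_unique` in the route's namespace, for the kerneliser of the
rev-8 pieces). [cite: BurungaleKobayashiNakamuraOta2026, §1.4 and Thm. 7.2 (arXiv:2608.06879 pp. 8, 41) (the bottom class; shape only)] -/
theorem bottomIndexExp_unique_of_frame (D : EllipticUnitClassData W p K 𝔭 κ γ ι φ Ω 𝓔) {c c' : ℕ}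
    (hc : D.HasBottomIndexExp c) (hc' : D.HasBottomIndexExp c') : c = c' :=
  EllipticUnitClassData.hasBottomIndexExp_unique D hc hc'

/-- **The relative reading of the K7r seam, as a shape for the rev-8 kerneliser**: with the datum `D`
and its exponent `c` as SHARED binders, an IMC-side identity `n₀ + log_p #X[T] = c` and a value-side
identity `c = n + n' + ord_p q + ord_p q'` compose to the (R-EU)-shaped identity
`n₀ + log_p #X[T] = n + n' + ord_p q + ord_p q'` for THAT datum — the content is in the two
hypotheses, exactly as in the planner's O11 seam `ramifiedCMEllipticUnitIndexAt_of_imc_of_indexLaw`,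
but no closed carrier predicate is quantified over (BETA-DESIGN §3). Trivial by design.
[cite: Miller2011LMS, Def. 1.1 (arXiv:1010.2431 p. 3)] -/
theorem indexIdentity_of_relative_laws (D : EllipticUnitClassData W p K 𝔭 κ γ ι φ Ω 𝓔) {c : ℕ}
    (_hc : D.HasBottomIndexExp c) {n₀ : ℤ} {t : ℕ} {n n' : ℕ} {vq vq' : ℤ}
    (hIMC : n₀ + (t : ℤ) = c) (hPR : (c : ℤ) = (n : ℤ) + n' + vq + vq') :
    n₀ + (t : ℤ) = (n : ℤ) + n' + vq + vq' :=
  hIMC.trans hPR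

/-! ### (B1) of the Rubin-formula line (planner D112 (e)): the bottom class is a genuine compact
Selmer element — [BKNO] Lemma 7.1 at `χ = 𝟙` in the tree's currency, PROVED relative to the datum -/

/-- **The bottom elliptic-unit class `z(𝟙)` lies in the FULL compact Selmer group `S_p(E/K)`**
(Kummer condition at `𝔭` included), i.e. it is crystalline at `𝔭` — [BKNO] Lemma 7.1 /
Thm. 1.8 at the trivial character ("for `k = 0`, the above Selmer classes are … the very classes
producing the Mordell–Weil rank growth"), read through the datum: by the explicit reciprocity law
`erl` every level-`0` value `δ 0 r (z 0) = ι⁻¹(L(φχ,1)/Ω)` VANISHES when the central values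
`L(φχ, 1)` of the level-`0` characters vanish (binder `hvan`: in analytic rank one this is
`L(φ, 1) = L(E/ℚ, 1) = 0`, the only level-`0` character being trivial), so by the exact-kernel reading
`δ_eq_zero_iff` the compatible family `z 0` is Kummer above `𝔭`, and `relaxed ⊓ localKummer = compact`
(`relaxedCompactSelmerOver_inf_localKummerPi`). First stub of the cut-(B) line; junk-free (a statement
about every datum relative to its own `𝓔`). [cite: BurungaleKobayashiNakamuraOta2026, Lemma 7.1 and Prop. 4.10 (arXiv:2608.06879 pp. 31, 40) (claim; preprint; shape only)] -/
theorem bottom_mem_compactSelmerOver (D : EllipticUnitClassData W p K 𝔭 κ γ ι φ Ω 𝓔)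
    (hvan : ∀ (χ : HeckeCharacter K) (r : FramedGaloisRep K (PadicAlgCl p) 1),
      IsAcCharacter ι κ 0 χ r →
        ∃ hL : LFunction.HasEntireContinuation (heckeLFunction (φ * χ)), hL.continuation 1 = 0) :
    D.z 0 ∈ (W.baseChange K).compactSelmerOver (κ.layerSubgroup 0) p := by
  have hrel : D.z 0 ∈ (W.baseChange K).relaxedCompactSelmerOver (κ.layerSubgroup 0) p {𝔭} :=
    D.z_mem 0
  have hcomp : D.z 0 ∈ (W.baseChange K).compatiblePi (κ.layerSubgroup 0) p :=
    (mem_relaxedCompactSelmerOver_iff.1 hrel).2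
  have hkum : D.z 0 ∈ (W.baseChange K).localKummerPi (κ.layerSubgroup 0) p {𝔭} := by
    refine (𝓔.δ_eq_zero_iff 0 _ hcomp).1 fun χ r h ↦ ?_
    obtain ⟨hL, h0⟩ := hvan χ r h
    rw [D.erl 0 χ r h hL, h0, zero_div, map_zero]
    rfl
  rw [← (W.baseChange K).relaxedCompactSelmerOver_inf_localKummerPi (κ.layerSubgroup 0) p {𝔭}]
  exact ⟨hrel, hkum⟩

/-- **The bottom class `z(𝟙)` as an element of `S_p(E/K) ⊆ ∏_k H¹(Γ_K, E[p^k])`, Kummer at EVERY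
place** — corollary phrased with `selmerTorsionOver` level by level: each component `(z 0) k` is a
`p^k`-Selmer class over `K`. [cite: BurungaleKobayashiNakamuraOta2026, Lemma 7.1 (arXiv:2608.06879 p. 40) (claim; preprint; shape only)] -/
theorem bottom_apply_mem_selmerTorsionOver (D : EllipticUnitClassData W p K 𝔭 κ γ ι φ Ω 𝓔)
    (hvan : ∀ (χ : HeckeCharacter K) (r : FramedGaloisRep K (PadicAlgCl p) 1),
      IsAcCharacter ι κ 0 χ r →
        ∃ hL : LFunction.HasEntireContinuation (heckeLFunction (φ * χ)), hL.continuation 1 = 0)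
    (k : ℕ) :
    D.z 0 k ∈ (W.baseChange K).selmerTorsionOver (κ.layerSubgroup 0) ((p : ℤ) ^ k) :=
  (((W.baseChange K).mem_compactSelmerOver_iff (κ.layerSubgroup 0) p (D.z 0)).1
    (bottom_mem_compactSelmerOver D hvan)).1 k

end BottomClass

end Summit.BirchSwinnertonDyer.BirchSwinnertonDyer.Theorems.RamifiedSevenEllipticUnits

end
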